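import Summits.BirchSwinnertonDyer.BirchSwinnertonDyer.Theorems.GenusKolyvaginAtTwoPowDvdShaCardAtTwoRTNonPhantomCoboundary
import Summits.BirchSwinnertonDyer.BirchSwinnertonDyer.Theorems.GenusKolyvaginAtTwoPowDvdShaCardAtTwoRTNonPhantomMultiplicativeInertia
import Literature.NumberTheory.EllipticCurves.PointDivisibilityProofs
import HarnessLib

/-!
# Route `GenusKolyvaginAtTwo`, crux L_T `PowDvdShaCardAtTwoRT` (stmt-BirchSwinnertonDyer-23242), LINE 18 stub L, bottom rung:
# the NON-PHANTOM lemma (V) — ASSEMBLY: a phantom class of `H¹(K, E[4])` that is Kummer at an odd multiplicative place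
# is zero; the separation hypothesis `hres` of the pair Čebotarev for free

Seat `bsd-line-gk2-p3` g22 (PROVER 3/3, cell `bsd-f1-sign2`), `--supports stmt-BirchSwinnertonDyer-23242` (helper).
THEOREMS ONLY (no definition, no named fact, no `sorry`). BSD is not proved by any of this; neither is the crux.

WHAT THIS CLOSES.  LEAD gk2-p1 g16's finding (B) (memo `Cruxes/PowDvdShaCardAtTwoRT/Lines/plus-descent-lead-g16.md` §11):
the (Čeb) clause of the index-`≥ 2` bottom-rung ENGINE `RelaxedCount.false_of_bottomRung_engine` is the full-order pair
Čebotarev `PlusDescent.infinite_kolyvaginPrime_localization_fullOrder_pair`, whose separation hypothesis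
`hres : ∀ a b, (∀ ρ ∈ Γ_{K(E[4])}, [a • c + b • y, ρ] = 0) → a • c + b • y = 0` is a NON-PHANTOM condition — the phantom
group `H¹(GL₂(ℤ/4), (ℤ/4)²)` is `ℤ/2` (Lawson–Wuthrich), generated by `φ₄ = ι φ₂`; gk2-p4 g18 discharges the `y`-summands by
COUNTING for `k ≥ 2` free primes, leaving «`2 c₂(n) ≠ φ₄|_K`» and the case `k = 1` OPEN.  THIS FILE: on every curve with
an odd prime `v` of MULTIPLICATIVE reduction with `ord_v Δ_min` odd (on the route's habitat EVERY multiplicative prime has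
odd `ord_p Δ`, as `c_p` is odd; the Heegner hypothesis splits it in `K`, and `ord` is unchanged), `hres` holds for ALL spans
of classes satisfying the local Kummer condition at `v` — no counting, every `k`, both summands at once:

* `eq_zero_of_h1Eval_eq_zero_of_unipotent` (any field of characteristic `0`): `ρ̄_{E,4}` onto, `u ∈ Γ_F` unipotent on `E[4]`
  moving `E[2]`, `x ∈ H¹(F, E[4])` with `[x, ρ] = 0` on `Γ_{F(E[4])}` and `[x, u] = u m − m` ⟹ `x = 0` (the algebra of files
  (I)–(III) on the chosen cocycle of `x`);
* `eq_zero_of_h1Eval_eq_zero_of_mem_selmerLocalKer` (number field): `ρ̄_{E,4}` onto, `v ∤ 2` multiplicative with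
  `ord_v Δ_min` odd, `x` a phantom in `selmerLocalKer W K_v 4` ⟹ `x = 0` (file (IV) supplies the inertial transvection and
  the principality on it);
* `hres_of_mem_selmerLocalKer` — the `hres` form for `c, y ∈ selmerLocalKer W K_v 4`.

CONSUMER NOTE (LEAD): instantiate with `W := W_ℚ.baseChange K`, `v` a prime of `K` over an odd `p ∥ N` (exists unless `N` is
`2^a ·`(additive part); the habitat's `Odd W.tamagawaProduct` gives `ord_p Δ` odd at multiplicative `p`); `c(n) ∈ selmerLocalKer`
at `v ∤ n` is `RankOneAtTwoOneDoor.kolyvaginClass_two_mem_selmerLocalKer_of_odd_tamagawaProduct`; `res_K y` is Kummer at `v`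
because `y ∈ H¹_{𝓛,⊤ on s∪t}(ℚ, E[4])` and `p ∉ s ∪ t`.  The remaining base-change bookkeeping (`HasMultiplicativeReductionAt`,
`ordMinimalDiscriminant` and `HasSurjectiveModNGaloisRep 4` for `W_ℚ.baseChange K`) is routine and left to the assembly.

References: [LawsonWuthrich2016] §7.1, §8; [GrossLMS1991] Prop. 9.1; [SilvermanAEC2009] X.§4; [SilvermanATAEC1994] IV.9.2 (d),
V.5, Ex. 5.13 (b); [SerreAbelianLadic1968] IV A.1.2; [McCallumLMS1991] §3.
-/

-- `Summit.<P>.<Sub>` repeats `BirchSwinnertonDyer` by the tree's layout convention (D-0017)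
set_option linter.dupNamespace false
set_option autoImplicit false

noncomputable section

open scoped Classical NNReal
open NumberField IsDedekindDomain Field

universe u

/-! ## §1 Any field: a phantom class of `H¹(F, E[4])` whose cocycle is principal on a Tate transvection is zero -/

namespace Summit.BirchSwinnertonDyer.BirchSwinnertonDyer.Theorems.GenusExact.NonPhantom

open WeierstrassCurve Literature.NumberTheory.EllipticCurves Literature.NumberTheory.GaloisRepresentations Field


variable {F : Type u} [Field F] (W : WeierstrassCurve F)

/-- `E[4]` is killed by `4`. [folklore] -/
theorem four_zsmul_geomTorsion_eq_zero {n : ℤ} (hn : n = 4) (m : geomTorsion W n) : (4 : ℤ) • m = 0 := by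
  subst hn
  exact Subtype.ext ((Submodule.mem_torsionBy_iff (4 : ℤ) (m : geomPoints W)).mp m.2)

/-- `E[4][2] ≤ 2 · E[4]` (divisibility of `E(F̄)`). [cite: SilvermanAEC2009, §VIII.2 and Prop. III.4.2(a)] -/
theorem exists_eq_two_zsmul_of_two_zsmul_eq_zero [W.IsElliptic] {n : ℤ} (hn : n = 4) (m : geomTorsion W n)
    (hm : (2 : ℤ) • m = 0) : ∃ y : geomTorsion W n, m = (2 : ℤ) • y := by
  subst hn
  obtain ⟨Q, hQ⟩ := W.zsmul_geomPoints_surjective_holds (n := (2 : ℤ)) two_ne_zero (m : geomPoints W)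
  have hQ4 : Q ∈ geomTorsion W (4 : ℤ) := by
    refine (Submodule.mem_torsionBy_iff (4 : ℤ) Q).mpr ?_
    have h2 : (2 : ℤ) • ((m : geomTorsion W 4) : geomPoints W) = 0 := by
      have := congrArg (fun z : geomTorsion W 4 ↦ (z : geomPoints W)) hm
      simpa using this
    change (4 : ℤ) • Q = 0
    rw [show (4 : ℤ) = 2 * 2 by norm_num, mul_smul]
    change (2 : ℤ) • ((fun Q : geomPoints W ↦ (2 : ℤ) • Q) Q) = 0
    rw [hQ]
    exact h2
  refine ⟨⟨Q, hQ4⟩, Subtype.ext ?_⟩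
  change (m : geomPoints W) = (2 : ℤ) • Q
  exact hQ.symm

/-- **THE NON-PHANTOM LEMMA in the tree's `H¹` currency** (level-`4` substitute for Gross's Prop. 9.1
`eq_zero_of_h1Eval_eq_zero`, which needs `2` invertible).  Let `E/F` be an elliptic curve (`char F = 0`) with
`ρ̄_{E,4} : Γ_F → Aut E[4]` SURJECTIVE, and let `u ∈ Γ_F` act unipotently on `E[4]` (`u (u P − P) = u P − P`) and
move a point of `E[2]` — e.g. the restriction of an inertia element at a place `v ∤ 2` of multiplicative reduction with
`ord_v Δ_min` odd (`WeierstrassCurve.exists_unipotent_geomTorsion_of_hasMultiplicativeReductionAt_of_not_dvd`).  If a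
class `x ∈ H¹(F, E[4])` has `[x, ρ] = 0` for every `ρ ∈ Γ_{F(E[4])}` (a PHANTOM class: it dies on restriction to
`F(E[4])`) and its cocycle is principal on `u` (`[x, u] = u m − m`, e.g. `x` unramified at that place), then `x = 0`.
Proof: `NonPhantom.coboundary_of_unipotent_of_surjective` applied to the chosen cocycle of `x`.
[cite: LawsonWuthrich2016, §7.1 and §8] [cite: GrossLMS1991, Prop. 9.1] [cite: SerreAbelianLadic1968, Ch. IV, A.1.2] -/
theorem eq_zero_of_h1Eval_eq_zero_of_unipotent [CharZero F] [W.IsElliptic] {n : ℤ} (hn : n = 4)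
    (hρ : W.HasSurjectiveModNGaloisRep n)
    {u : absoluteGaloisGroup F} (hu₁ : ∀ P : geomTorsion W n, u • (u • P - P) = u • P - P)
    (hu₂ : ∃ Q : geomTorsion W n, (2 : ℤ) • Q = 0 ∧ u • Q ≠ Q)
    {x : galH1Torsion W n} (hx : ∀ ρ ∈ torsionFixing W n, h1Eval W n x ρ = 0)
    (hxu : ∃ m : geomTorsion W n, h1Eval W n x u = u • m - m) : x = 0 := by
  have hM4 := four_zsmul_geomTorsion_eq_zero W hn
  have h2M := exists_eq_two_zsmul_of_two_zsmul_eq_zero W hn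
  have hcard : Nat.card (geomTorsion W n) = 16 := by
    rw [natCard_geomTorsion W n (by rw [hn]; norm_num), hn]; rfl
  -- the chosen cocycle of `x`
  have hφ : ∀ g h, (reprCocycle W n x).1 (g * h) = (reprCocycle W n x).1 g + g • (reprCocycle W n x).1 h :=
    fun g h ↦ by have := (reprCocycle W n x).2 g h; rwa [discreteTopRep_ρ_apply] at this
  have hker : ∀ ρ : absoluteGaloisGroup F, (∀ m : geomTorsion W n, ρ • m = m) → (reprCocycle W n x).1 ρ = 0 :=
    fun ρ hρ ↦ hx ρ ((mem_torsionFixing_iff W n).mpr hρ)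
  have hsurj : ∀ f : geomTorsion W n ≃+ geomTorsion W n, ∃ g : absoluteGaloisGroup F, ∀ m, g • m = f m := by
    intro f
    obtain ⟨g, hg⟩ := hρ (Multiplicative.ofAdd f)
    refine ⟨g, fun m ↦ ?_⟩
    rw [← galoisRepTorsion_apply W n g m, hg]
    rfl
  obtain ⟨v, hv⟩ := coboundary_of_unipotent_of_surjective hM4 hcard h2M hsurj hu₁ hu₂ hφ hker hxu
  rw [← oneCocycleClass_reprCocycle W n x]
  exact (oneCocycleClass_eq_zero_iff _ _).mpr ⟨v, fun g ↦ by rw [discreteTopRep_ρ_apply]; exact hv g⟩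

end Summit.BirchSwinnertonDyer.BirchSwinnertonDyer.Theorems.GenusExact.NonPhantom

/-! ## §2 Number fields: a phantom class that is Kummer at an odd multiplicative place is zero; the `hres` form -/

namespace Summit.BirchSwinnertonDyer.BirchSwinnertonDyer.Theorems.GenusExact.NonPhantom

open WeierstrassCurve Literature.NumberTheory.EllipticCurves Literature.NumberTheory.GaloisRepresentations
  IsDedekindDomain.HeightOneSpectrum
  Literature.NumberTheory.GaloisRepresentations.IsNonarchimedeanLocalField

variable {K : Type u} [Field K] [NumberField K] (W : WeierstrassCurve K) {v : HeightOneSpectrum (𝓞 K)}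

/-- `m` is a unit of `𝓞_v` when `v ∤ m`. [folklore] -/
theorem isUnit_natCast_adicCompletionIntegers {m : ℕ} (hmv : ((m : ℕ) : 𝓞 K) ∉ v.asIdeal) :
    IsUnit ((m : ℕ) : v.adicCompletionIntegers K) := by
  refine (LocalPoints.isUnit_iff_valuation_eq_one v (m : v.adicCompletionIntegers K)).mpr ?_
  have h1 := LocalPoints.valuation_natCast_eq_one (K := K) v hmv
  simpa using h1

/-- `4` is a unit at a place not above `2`. [folklore] -/
theorem isUnit_four_adicCompletionIntegers (h2v : ((2 : ℕ) : 𝓞 K) ∉ v.asIdeal) :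
    IsUnit ((4 : ℕ) : v.adicCompletionIntegers K) := by
  have h2 := isUnit_natCast_adicCompletionIntegers (K := K) (v := v) (m := 2) h2v
  have e : ((4 : ℕ) : v.adicCompletionIntegers K) = ((2 : ℕ) : v.adicCompletionIntegers K) ^ 2 := by norm_num
  rw [e]
  exact h2.pow 2

/-- **THE NON-PHANTOM LEMMA at an odd multiplicative place.**  Let `E/K` be an elliptic curve over a number field with
`ρ̄_{E,4} : Γ_K → Aut E[4]` surjective, and `v ∤ 2` a place of MULTIPLICATIVE reduction with `ord_v Δ_min` ODD.  A class
`x ∈ H¹(K, E[4])` which (i) is a PHANTOM — `[x, ρ] = 0` for all `ρ ∈ Γ_{K(E[4])}`, i.e. `x` dies in `H¹(K(E[4]), E[4])` —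
and (ii) satisfies the local Kummer (Selmer) condition at `v` (`x ∈ selmerLocalKer W K_v 4`) is ZERO.  Proof: the inertia
group at `v` contains `τ` acting on `E[4]` as the Tate transvection (`exists_absInertia_unipotent_of_…`, `2 ∤ ord_v Δ`);
the cocycle of `x` is principal on `τ` (`exists_h1Eval_resGal_eq_of_mem_selmerLocalKer`, `gcd(4, ord_v Δ) = 1`); and
`H¹(GL₂(ℤ/4), (ℤ/4)²) → H¹(⟨τ⟩, (ℤ/4)²)` is injective (`eq_zero_of_h1Eval_eq_zero_of_unipotent`).  In particular the
Lawson–Wuthrich phantom `φ₄` is NOT Selmer at such a place.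
[cite: LawsonWuthrich2016, §7.1 and §8] [cite: SilvermanATAEC1994, Exercise 5.13 (b) and Cor. IV.9.2 (d)]
[cite: GrossLMS1991, Prop. 9.1] -/
theorem eq_zero_of_h1Eval_eq_zero_of_mem_selmerLocalKer [W.IsElliptic]
    (hmult : W.HasMultiplicativeReductionAt v) (h2v : ((2 : ℕ) : 𝓞 K) ∉ v.asIdeal)
    (hodd : Odd (W.ordMinimalDiscriminant v)) {n : ℤ} (hn : n = 4) (hρ : W.HasSurjectiveModNGaloisRep n)
    {x : galH1Torsion W n} (hx : ∀ ρ ∈ torsionFixing W n, h1Eval W n x ρ = 0)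
    (hxv : x ∈ selmerLocalKer W (v.adicCompletion K) n) : x = 0 := by
  subst hn
  have hndvd : ¬ 2 ∣ W.ordMinimalDiscriminant v := hodd.not_two_dvd_nat
  obtain ⟨τ, hτ, hu₁, Q, hQ2, hQne⟩ := exists_absInertia_unipotent_of_hasMultiplicativeReductionAt W hmult
    Nat.prime_two h2v hndvd (k := 2) (by norm_num) (N := (4 : ℤ)) (by norm_num)
  have hcop : (4 : ℕ).Coprime (W.ordMinimalDiscriminant v) := by
    have h2 : Nat.Coprime 2 (W.ordMinimalDiscriminant v) := Nat.coprime_two_left.mpr hodd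
    simpa using h2.pow_left 2
  obtain ⟨m, hm⟩ := exists_h1Eval_resGal_eq_of_mem_selmerLocalKer W hmult (n := 4) (by norm_num)
    (isUnit_four_adicCompletionIntegers h2v) hcop hxv hτ
  refine eq_zero_of_h1Eval_eq_zero_of_unipotent W rfl hρ hu₁ ⟨Q, ?_, hQne⟩ hx ⟨m, hm⟩
  rw [two_zsmul]
  rwa [two_nsmul] at hQ2

/-- **The separation hypothesis `hres` of the pair Čebotarev, for spans of classes that are Kummer at an odd
multiplicative place.**  Same curve and place; if `c, y ∈ H¹(K, E[4])` both satisfy the local Kummer condition at `v`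
(for a Kolyvagin class `c(n)` with `v ∤ n`: Gross 6.2 (1) / McCallum 4.3 on the odd-Tamagawa habitat; for the restriction
of a ℚ-class in `H¹_{𝓛,⊤ on s∪t}`: `v ∉ s ∪ t`), then no non-zero `a • c + b • y` is a phantom — exactly the
hypothesis `hres` of `PlusDescent.infinite_kolyvaginPrime_localization_fullOrder_pair` at `M = 2` and of the LEAD's
`RelaxedCount.false_of_bottomRung_engine` (finding (B), LW phantom), with no counting and for every `k`.
[cite: LawsonWuthrich2016, §7.1 and §8] [cite: McCallumLMS1991, §3 Cor. 3.2] -/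
theorem hres_of_mem_selmerLocalKer [W.IsElliptic]
    (hmult : W.HasMultiplicativeReductionAt v) (h2v : ((2 : ℕ) : 𝓞 K) ∉ v.asIdeal)
    (hodd : Odd (W.ordMinimalDiscriminant v)) {n : ℤ} (hn : n = 4) (hρ : W.HasSurjectiveModNGaloisRep n)
    {c y : galH1Torsion W n} (hc : c ∈ selmerLocalKer W (v.adicCompletion K) n)
    (hy : y ∈ selmerLocalKer W (v.adicCompletion K) n) :
    ∀ a b : ℤ, (∀ ρ ∈ torsionFixing W n, h1Eval W n (a • c + b • y) ρ = 0) → a • c + b • y = 0 :=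
  fun a b hab ↦ eq_zero_of_h1Eval_eq_zero_of_mem_selmerLocalKer W hmult h2v hodd hn hρ hab
    ((selmerLocalKer W _ n).add_mem ((selmerLocalKer W _ n).zsmul_mem hc a)
      ((selmerLocalKer W _ n).zsmul_mem hy b))

end Summit.BirchSwinnertonDyer.BirchSwinnertonDyer.Theorems.GenusExact.NonPhantom

end
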